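import Literature.Barriers.CriticalPhenomena.PlanarEdwardsModelDiffusiveVaradhanProofs
import HarnessLib

/-!
# The limit of the covariance density of the mollified self-intersection local times

Sibling proof file of `…PlanarEdwardsModelDiffusiveSILTMoments/Bounds/Integral` and
`…VaradhanProofs`. There `Cov(T_k, T_l) = ∫_{[0,1]⁴} Φ_{k,l}` (`covariance_mollifiedSILT`) with the
closed form `Φ_{k,l} = (1/(2π)²) c²/(AB(AB - c²))`, `A = a + 1/k`, `B = b + 1/l`
(`covDensity_eq`; `a = |t - s|`, `b = |v - u|`, `c` the signed overlap `incrCov`), monotone in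
`k, l` (`covDensity_mono`) with `∫ Φ_{k,l} ≤ 57` (`integral_covDensity_le`), whence an abstract
limit `L = lim Cov(T_k, T_l)` (`exists_limit_covariance`). Here the diagonal limit is computed in
closed form (Beppo Levi):

* `tendsto_covDensity_diag_of_sq_lt` — off the singular set `{c² = ab}`,
  `Φ_{k,k} → Φ_∞ = (1/(2π)²) c²/(ab(ab - c²))`;
* `tendsto_covDensity_diag_atTop` — on `{c ≠ 0, c² = ab}`, `Φ_{k,k} → ∞`;
* `ae_tendsto_covDensity_diag` — hence (the increasing `Φ_{k,k}` having bounded integrals) the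
  singular set is null and `Φ_{k,k} → Φ_∞` a.e. on `[0,1]⁴`;
* `integrable_limCovDensity`, `tendsto_integral_covDensity_diag` — `Φ_∞ ∈ L¹([0,1]⁴)` and
  `∫ Φ_{k,k} → ∫ Φ_∞`;
* `tendsto_variance_mollifiedSILT` — for every planar Brownian motion, `Var(T_k) → ∫_{[0,1]⁴} Φ_∞`;
* `integral_sq_renormalisedSILT_eq` — hence `E γ² = ∫_{[0,1]⁴} Φ_∞` for the `L²` limit `γ` of the
  centred `T_k` (Varadhan's renormalised self-intersection local time).

This makes the target of the remaining second-moment limit (α₁) behind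
`Edwards2D.Stoll1989_invariance_of_secondMomentLimits` an explicit number:
`E γ² = ∫_{[0,1]⁴} (1/(2π)²) c²/(ab(ab - c²))`.

## References

* S. R. S. Varadhan, appendix to K. Symanzik, *Euclidean quantum field theory* (1969).
* J.-F. Le Gall, Sém. Probab. XIX, LNM 1123 (1985), 314–331, §2.
* A. Stoll, Math. Scand. 64 (1989), §2.
-/

noncomputable section

open MeasureTheory ProbabilityTheory Real Filter Set Function Topology
open scoped NNReal ENNReal BigOperators

namespace Literature.Barriers.CriticalPhenomena

namespace Edwards2D

open Literature.Probability.Process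

variable (pq : (ℝ × ℝ) × (ℝ × ℝ))

/-- **Pointwise limit off the singular set**: if `c² < ab` then
`Φ_{k,k} → (1/(2π)²) c²/(ab(ab - c²))`. [folklore] -/
theorem tendsto_covDensity_diag_of_sq_lt
    (h : incrCov pq.1.1.toNNReal pq.1.2.toNNReal pq.2.1.toNNReal pq.2.2.toNNReal ^ 2 <
      |((pq.1.2.toNNReal : ℝ≥0) : ℝ) - pq.1.1.toNNReal| * |((pq.2.2.toNNReal : ℝ≥0) : ℝ) - pq.2.1.toNNReal|) :
    Tendsto (fun k : ℕ => covDensity k k pq) atTop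
      (𝓝 (1 / (2 * π) ^ 2 *
        (incrCov pq.1.1.toNNReal pq.1.2.toNNReal pq.2.1.toNNReal pq.2.2.toNNReal ^ 2 /
          (|((pq.1.2.toNNReal : ℝ≥0) : ℝ) - pq.1.1.toNNReal| * |((pq.2.2.toNNReal : ℝ≥0) : ℝ) - pq.2.1.toNNReal| *
            (|((pq.1.2.toNNReal : ℝ≥0) : ℝ) - pq.1.1.toNNReal| *
                |((pq.2.2.toNNReal : ℝ≥0) : ℝ) - pq.2.1.toNNReal| -
              incrCov pq.1.1.toNNReal pq.1.2.toNNReal pq.2.1.toNNReal pq.2.2.toNNReal ^ 2))))) := by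
  set a := |((pq.1.2.toNNReal : ℝ≥0) : ℝ) - pq.1.1.toNNReal| with ha
  set b := |((pq.2.2.toNNReal : ℝ≥0) : ℝ) - pq.2.1.toNNReal| with hb
  set c := incrCov pq.1.1.toNNReal pq.1.2.toNNReal pq.2.1.toNNReal pq.2.2.toNNReal with hc
  have hk : Tendsto (fun k : ℕ => (1 : ℝ) / k) atTop (𝓝 0) := tendsto_one_div_atTop_nhds_zero_nat
  have hA : Tendsto (fun k : ℕ => a + 1 / (k : ℝ)) atTop (𝓝 a) := by
    simpa using tendsto_const_nhds.add hk
  have hB : Tendsto (fun k : ℕ => b + 1 / (k : ℝ)) atTop (𝓝 b) := by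
    simpa using tendsto_const_nhds.add hk
  have hAB := hA.mul hB
  have hden := hAB.mul (hAB.sub (tendsto_const_nhds (x := c ^ 2)))
  have hne : a * b * (a * b - c ^ 2) ≠ 0 := by
    have h0 : 0 ≤ c ^ 2 := sq_nonneg c
    have hab : 0 < a * b := lt_of_le_of_lt h0 h
    exact mul_ne_zero hab.ne' (sub_pos.2 h).ne'
  have hlim := (tendsto_const_nhds (x := c ^ 2)).div hden hne
  refine ((tendsto_const_nhds (x := 1 / (2 * π) ^ 2)).mul hlim).congr' ?_
  filter_upwards [eventually_ge_atTop 1] with k hk1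
  rw [covDensity_eq k k pq hk1 hk1]
  simp only [Pi.div_apply, ha, hb, hc]

/-- **On the singular set the densities blow up**: if `c ≠ 0` and `c² = ab` then `Φ_{k,k} → ∞`
(`AB - c² = (a + b)/k + 1/k² ≤ (a + b + 1)/k`). [folklore] -/
theorem tendsto_covDensity_diag_atTop
    (hc : incrCov pq.1.1.toNNReal pq.1.2.toNNReal pq.2.1.toNNReal pq.2.2.toNNReal ≠ 0)
    (h : incrCov pq.1.1.toNNReal pq.1.2.toNNReal pq.2.1.toNNReal pq.2.2.toNNReal ^ 2 =
      |((pq.1.2.toNNReal : ℝ≥0) : ℝ) - pq.1.1.toNNReal| * |((pq.2.2.toNNReal : ℝ≥0) : ℝ) - pq.2.1.toNNReal|) :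
    Tendsto (fun k : ℕ => covDensity k k pq) atTop atTop := by
  set a := |((pq.1.2.toNNReal : ℝ≥0) : ℝ) - pq.1.1.toNNReal| with ha
  set b := |((pq.2.2.toNNReal : ℝ≥0) : ℝ) - pq.2.1.toNNReal| with hb
  set c := incrCov pq.1.1.toNNReal pq.1.2.toNNReal pq.2.1.toNNReal pq.2.2.toNNReal with hc'
  have ha0 : 0 ≤ a := abs_nonneg _
  have hb0 : 0 ≤ b := abs_nonneg _
  have hc2 : 0 < c ^ 2 := by positivity
  set C : ℝ := 1 / (2 * π) ^ 2 * (c ^ 2 / ((a + 1) * (b + 1) * (a + b + 1))) with hC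
  have hCpos : 0 < C := by positivity
  have hlow : Tendsto (fun k : ℕ => C * k) atTop atTop :=
    Tendsto.const_mul_atTop hCpos tendsto_natCast_atTop_atTop
  refine tendsto_atTop_mono' atTop ?_ hlow
  filter_upwards [eventually_ge_atTop 1] with k hk1
  have hk0 : (0 : ℝ) < k := by exact_mod_cast hk1
  have hk1' : (1 : ℝ) / k ≤ 1 := by rw [div_le_one hk0]; exact_mod_cast hk1
  have hkinv : (0 : ℝ) < 1 / k := by positivity
  rw [covDensity_eq k k pq hk1 hk1]
  change C * k ≤ 1 / (2 * π) ^ 2 * (c ^ 2 / ((a + 1 / k) * (b + 1 / k) * ((a + 1 / k) * (b + 1 / k) - c ^ 2)))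
  -- the denominator is at most `(a+1)(b+1)(a+b+1)/k`
  have hδ : (a + 1 / k) * (b + 1 / k) - c ^ 2 = (a + b) * (1 / k) + (1 / k) ^ 2 := by rw [h]; ring
  have hδpos : 0 < (a + 1 / k) * (b + 1 / k) - c ^ 2 := by rw [hδ]; positivity
  have hδle : (a + 1 / k) * (b + 1 / k) - c ^ 2 ≤ (a + b + 1) * (1 / k) := by
    rw [hδ]
    have : (1 / (k : ℝ)) ^ 2 ≤ 1 * (1 / k) := by rw [sq]; exact mul_le_mul_of_nonneg_right hk1' hkinv.le
    nlinarith
  have hABle : (a + 1 / k) * (b + 1 / k) ≤ (a + 1) * (b + 1) :=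
    mul_le_mul (by linarith) (by linarith) (by positivity) (by positivity)
  have hden_le : (a + 1 / k) * (b + 1 / k) * ((a + 1 / k) * (b + 1 / k) - c ^ 2) ≤
      (a + 1) * (b + 1) * (a + b + 1) * (1 / k) := by
    calc (a + 1 / k) * (b + 1 / k) * ((a + 1 / k) * (b + 1 / k) - c ^ 2)
        ≤ (a + 1) * (b + 1) * ((a + b + 1) * (1 / k)) :=
          mul_le_mul hABle hδle hδpos.le (by positivity)
      _ = _ := by ring
  have hden_pos : 0 < (a + 1 / k) * (b + 1 / k) * ((a + 1 / k) * (b + 1 / k) - c ^ 2) :=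
    mul_pos (by positivity) hδpos
  have key : c ^ 2 / ((a + 1) * (b + 1) * (a + b + 1)) * k ≤
      c ^ 2 / ((a + 1 / k) * (b + 1 / k) * ((a + 1 / k) * (b + 1 / k) - c ^ 2)) := by
    rw [div_mul_eq_mul_div, mul_comm (c ^ 2) (k : ℝ), mul_div_assoc]
    rw [show c ^ 2 / ((a + 1 / k) * (b + 1 / k) * ((a + 1 / k) * (b + 1 / k) - c ^ 2)) =
      (1 / ((a + 1 / k) * (b + 1 / k) * ((a + 1 / k) * (b + 1 / k) - c ^ 2))) * c ^ 2 by ring,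
      show (k : ℝ) * (c ^ 2 / ((a + 1) * (b + 1) * (a + b + 1))) =
        (k / ((a + 1) * (b + 1) * (a + b + 1))) * c ^ 2 by ring]
    refine mul_le_mul_of_nonneg_right ?_ hc2.le
    rw [div_le_div_iff₀ (by positivity) hden_pos, one_mul]
    calc (k : ℝ) * ((a + 1 / k) * (b + 1 / k) * ((a + 1 / k) * (b + 1 / k) - c ^ 2))
        ≤ k * ((a + 1) * (b + 1) * (a + b + 1) * (1 / k)) :=
          mul_le_mul_of_nonneg_left hden_le hk0.le
      _ = (a + 1) * (b + 1) * (a + b + 1) := by field_simp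
  calc C * k = 1 / (2 * π) ^ 2 * (c ^ 2 / ((a + 1) * (b + 1) * (a + b + 1)) * k) := by rw [hC]; ring
    _ ≤ _ := mul_le_mul_of_nonneg_left key (by positivity)

/-- **`Φ_{k,k} → Φ_∞` almost everywhere on `[0,1]⁴`**: the increasing densities have integrals
`≤ 57`, so their supremum is a.e. finite (Beppo Levi), which rules out the singular set
`{c ≠ 0, c² = ab}`; elsewhere `tendsto_covDensity_diag_of_sq_lt` (or `c = 0`, where all vanish).
[folklore] -/
theorem ae_tendsto_covDensity_diag :
    ∀ᵐ pq ∂(unitSq.prod unitSq), Tendsto (fun k : ℕ => covDensity k k pq) atTop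
      (𝓝 (1 / (2 * π) ^ 2 *
        (incrCov pq.1.1.toNNReal pq.1.2.toNNReal pq.2.1.toNNReal pq.2.2.toNNReal ^ 2 /
          (|((pq.1.2.toNNReal : ℝ≥0) : ℝ) - pq.1.1.toNNReal| * |((pq.2.2.toNNReal : ℝ≥0) : ℝ) - pq.2.1.toNNReal| *
            (|((pq.1.2.toNNReal : ℝ≥0) : ℝ) - pq.1.1.toNNReal| *
                |((pq.2.2.toNNReal : ℝ≥0) : ℝ) - pq.2.1.toNNReal| -
              incrCov pq.1.1.toNNReal pq.1.2.toNNReal pq.2.1.toNNReal pq.2.2.toNNReal ^ 2))))) := by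
  have hmeas : ∀ k, AEMeasurable (fun pq => ENNReal.ofReal (covDensity k k pq)) (unitSq.prod unitSq) :=
    fun k => (integrable_covDensity k k).aestronglyMeasurable.aemeasurable.ennreal_ofReal
  have hmono : ∀ pq, Monotone fun k : ℕ => ENNReal.ofReal (covDensity k k pq) := fun pq k k' hkk' =>
    ENNReal.ofReal_le_ofReal (covDensity_mono hkk' hkk' pq)
  have hlin : ∫⁻ pq, (⨆ k, ENNReal.ofReal (covDensity k k pq)) ∂(unitSq.prod unitSq) ≤ ENNReal.ofReal 57 := by
    rw [lintegral_iSup' hmeas (ae_of_all _ hmono)]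
    refine iSup_le fun k => ?_
    rw [← ofReal_integral_eq_lintegral_ofReal (integrable_covDensity k k)
      (ae_of_all _ (covDensity_nonneg k k))]
    exact ENNReal.ofReal_le_ofReal (integral_covDensity_le k k)
  have hfin : ∀ᵐ pq ∂(unitSq.prod unitSq), (⨆ k, ENNReal.ofReal (covDensity k k pq)) < ∞ :=
    ae_lt_top' (AEMeasurable.iSup hmeas) (lt_of_le_of_lt hlin ENNReal.ofReal_lt_top).ne
  filter_upwards [hfin] with pq hpq
  by_cases hc : incrCov pq.1.1.toNNReal pq.1.2.toNNReal pq.2.1.toNNReal pq.2.2.toNNReal = 0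
  · simp only [hc, ne_eq, OfNat.ofNat_ne_zero, not_false_eq_true, zero_pow, zero_div, mul_zero]
    refine tendsto_const_nhds.congr' ?_
    filter_upwards [eventually_ge_atTop 1] with k hk1
    rw [covDensity_eq k k pq hk1 hk1, hc]
    simp
  by_cases hlt : incrCov pq.1.1.toNNReal pq.1.2.toNNReal pq.2.1.toNNReal pq.2.2.toNNReal ^ 2 < |((pq.1.2.toNNReal : ℝ≥0) : ℝ) - pq.1.1.toNNReal| * |((pq.2.2.toNNReal : ℝ≥0) : ℝ) - pq.2.1.toNNReal|
  · exact tendsto_covDensity_diag_of_sq_lt pq hlt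
  · exfalso
    have heq : incrCov pq.1.1.toNNReal pq.1.2.toNNReal pq.2.1.toNNReal pq.2.2.toNNReal ^ 2 = |((pq.1.2.toNNReal : ℝ≥0) : ℝ) - pq.1.1.toNNReal| * |((pq.2.2.toNNReal : ℝ≥0) : ℝ) - pq.2.1.toNNReal| := le_antisymm (sq_incrCov_le _ _ _ _) (not_lt.1 hlt)
    have hdiv := tendsto_covDensity_diag_atTop pq hc heq
    have htop : (⨆ k, ENNReal.ofReal (covDensity k k pq)) = ∞ := by
      refine ENNReal.eq_top_of_forall_nnreal_le fun r => ?_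
      obtain ⟨k, hk⟩ := (tendsto_atTop_atTop.1 hdiv) r
      calc (r : ℝ≥0∞) = ENNReal.ofReal r := by simp
        _ ≤ ENNReal.ofReal (covDensity k k pq) := ENNReal.ofReal_le_ofReal (hk k le_rfl)
        _ ≤ ⨆ k, ENNReal.ofReal (covDensity k k pq) := le_iSup (fun k => ENNReal.ofReal (covDensity k k pq)) k
    exact (lt_irrefl _) (htop ▸ hpq)

/-- **The limit density `Φ_∞ = (1/(2π)²) c²/(ab(ab - c²))` is integrable on `[0,1]⁴`** (Fatou /
Beppo Levi: `∫ Φ_∞ ≤ 57`). [folklore] -/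
theorem integrable_limCovDensity :
    Integrable (fun pq : (ℝ × ℝ) × (ℝ × ℝ) => (1 / (2 * π) ^ 2 *
        (incrCov pq.1.1.toNNReal pq.1.2.toNNReal pq.2.1.toNNReal pq.2.2.toNNReal ^ 2 /
          (|((pq.1.2.toNNReal : ℝ≥0) : ℝ) - pq.1.1.toNNReal| * |((pq.2.2.toNNReal : ℝ≥0) : ℝ) - pq.2.1.toNNReal| *
            (|((pq.1.2.toNNReal : ℝ≥0) : ℝ) - pq.1.1.toNNReal| *
                |((pq.2.2.toNNReal : ℝ≥0) : ℝ) - pq.2.1.toNNReal| -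
              incrCov pq.1.1.toNNReal pq.1.2.toNNReal pq.2.1.toNNReal pq.2.2.toNNReal ^ 2))))) (unitSq.prod unitSq) := by
  have hae := ae_tendsto_covDensity_diag
  refine ⟨aestronglyMeasurable_of_tendsto_ae atTop
    (fun k => (integrable_covDensity k k).aestronglyMeasurable) hae, ?_⟩
  have hmeas : ∀ k, AEMeasurable (fun pq => ENNReal.ofReal (covDensity k k pq)) (unitSq.prod unitSq) :=
    fun k => (integrable_covDensity k k).aestronglyMeasurable.aemeasurable.ennreal_ofReal
  have hmono : ∀ pq, Monotone fun k : ℕ => ENNReal.ofReal (covDensity k k pq) := fun pq k k' hkk' =>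
    ENNReal.ofReal_le_ofReal (covDensity_mono hkk' hkk' pq)
  have hlin : ∫⁻ pq, (⨆ k, ENNReal.ofReal (covDensity k k pq)) ∂(unitSq.prod unitSq) ≤ ENNReal.ofReal 57 := by
    rw [lintegral_iSup' hmeas (ae_of_all _ hmono)]
    refine iSup_le fun k => ?_
    rw [← ofReal_integral_eq_lintegral_ofReal (integrable_covDensity k k)
      (ae_of_all _ (covDensity_nonneg k k))]
    exact ENNReal.ofReal_le_ofReal (integral_covDensity_le k k)
  have h1 : ∀ᵐ pq ∂(unitSq.prod unitSq), ‖(1 / (2 * π) ^ 2 *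
        (incrCov pq.1.1.toNNReal pq.1.2.toNNReal pq.2.1.toNNReal pq.2.2.toNNReal ^ 2 /
          (|((pq.1.2.toNNReal : ℝ≥0) : ℝ) - pq.1.1.toNNReal| * |((pq.2.2.toNNReal : ℝ≥0) : ℝ) - pq.2.1.toNNReal| *
            (|((pq.1.2.toNNReal : ℝ≥0) : ℝ) - pq.1.1.toNNReal| *
                |((pq.2.2.toNNReal : ℝ≥0) : ℝ) - pq.2.1.toNNReal| -
              incrCov pq.1.1.toNNReal pq.1.2.toNNReal pq.2.1.toNNReal pq.2.2.toNNReal ^ 2))))‖ₑ = ⨆ k, ENNReal.ofReal (covDensity k k pq) := by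
    filter_upwards [hae] with pq hpq
    have hnn : 0 ≤ (1 / (2 * π) ^ 2 *
        (incrCov pq.1.1.toNNReal pq.1.2.toNNReal pq.2.1.toNNReal pq.2.2.toNNReal ^ 2 /
          (|((pq.1.2.toNNReal : ℝ≥0) : ℝ) - pq.1.1.toNNReal| * |((pq.2.2.toNNReal : ℝ≥0) : ℝ) - pq.2.1.toNNReal| *
            (|((pq.1.2.toNNReal : ℝ≥0) : ℝ) - pq.1.1.toNNReal| *
                |((pq.2.2.toNNReal : ℝ≥0) : ℝ) - pq.2.1.toNNReal| -
              incrCov pq.1.1.toNNReal pq.1.2.toNNReal pq.2.1.toNNReal pq.2.2.toNNReal ^ 2)))) := ge_of_tendsto' hpq fun k => covDensity_nonneg k k pq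
    rw [Real.enorm_eq_ofReal hnn]
    exact tendsto_nhds_unique ((ENNReal.continuous_ofReal.tendsto _).comp hpq)
      (tendsto_atTop_iSup (hmono pq))
  unfold HasFiniteIntegral
  rw [lintegral_congr_ae h1]
  exact lt_of_le_of_lt hlin ENNReal.ofReal_lt_top

/-- **`∫ Φ_{k,k} → ∫ Φ_∞`** (monotone convergence). [folklore] -/
theorem tendsto_integral_covDensity_diag :
    Tendsto (fun k : ℕ => ∫ pq, covDensity k k pq ∂(unitSq.prod unitSq)) atTop
      (𝓝 (∫ pq, (1 / (2 * π) ^ 2 *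
        (incrCov pq.1.1.toNNReal pq.1.2.toNNReal pq.2.1.toNNReal pq.2.2.toNNReal ^ 2 /
          (|((pq.1.2.toNNReal : ℝ≥0) : ℝ) - pq.1.1.toNNReal| * |((pq.2.2.toNNReal : ℝ≥0) : ℝ) - pq.2.1.toNNReal| *
            (|((pq.1.2.toNNReal : ℝ≥0) : ℝ) - pq.1.1.toNNReal| *
                |((pq.2.2.toNNReal : ℝ≥0) : ℝ) - pq.2.1.toNNReal| -
              incrCov pq.1.1.toNNReal pq.1.2.toNNReal pq.2.1.toNNReal pq.2.2.toNNReal ^ 2)))) ∂(unitSq.prod unitSq))) :=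
  integral_tendsto_of_tendsto_of_monotone (fun k => integrable_covDensity k k) integrable_limCovDensity
    (ae_of_all _ fun pq _ _ h => covDensity_mono h h pq) ae_tendsto_covDensity_diag

/-- **The variances of the mollified self-intersection local times converge to `∫ Φ_∞`**: for
every planar Brownian motion (measurable marginals, continuous paths),
`Var(T_k) = Cov(T_k,T_k) → ∫_{[0,1]⁴} (1/(2π)²) c²/(ab(ab - c²))`. [cite: LeGall1985, §2] -/
theorem tendsto_variance_mollifiedSILT {Ω : Type*} [MeasurableSpace Ω] {P : Measure Ω}
    [IsProbabilityMeasure P] {Z : ℝ≥0 → Ω → ℂ} (hZ : IsBrownianComplex Z P)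
    (hmeas : ∀ t, Measurable (Z t)) (hcont : ∀ ω, Continuous (Z · ω)) :
    Tendsto (fun k : ℕ => cov[mollifiedSILT Z k, mollifiedSILT Z k; P]) atTop
      (𝓝 (∫ pq, (1 / (2 * π) ^ 2 *
        (incrCov pq.1.1.toNNReal pq.1.2.toNNReal pq.2.1.toNNReal pq.2.2.toNNReal ^ 2 /
          (|((pq.1.2.toNNReal : ℝ≥0) : ℝ) - pq.1.1.toNNReal| * |((pq.2.2.toNNReal : ℝ≥0) : ℝ) - pq.2.1.toNNReal| *
            (|((pq.1.2.toNNReal : ℝ≥0) : ℝ) - pq.1.1.toNNReal| *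
                |((pq.2.2.toNNReal : ℝ≥0) : ℝ) - pq.2.1.toNNReal| -
              incrCov pq.1.1.toNNReal pq.1.2.toNNReal pq.2.1.toNNReal pq.2.2.toNNReal ^ 2)))) ∂(unitSq.prod unitSq))) := by
  simp_rw [covariance_mollifiedSILT hZ hmeas hcont]
  exact tendsto_integral_covDensity_diag


/-- `‖g‖₂² = ∫ g²` for real `g ∈ L²`. [folklore] -/
theorem toReal_eLpNorm_two_sq {Ω : Type*} [MeasurableSpace Ω] {P : Measure Ω} {g : Ω → ℝ}
    (hg : MemLp g 2 P) : (eLpNorm g 2 P).toReal ^ 2 = ∫ ω, g ω ^ 2 ∂P := by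
  rw [hg.eLpNorm_eq_integral_rpow_norm (by norm_num) (by norm_num), ENNReal.toReal_ofReal (by positivity)]
  simp only [ENNReal.toReal_ofNat, Real.rpow_two, sq_abs, Real.norm_eq_abs]
  rw [show ((2 : ℝ)⁻¹) = ((2 : ℕ) : ℝ)⁻¹ by norm_num,
    Real.rpow_inv_natCast_pow (integral_nonneg fun ω => sq_nonneg _) two_ne_zero]

/-- **`E γ² = ∫_{[0,1]⁴} Φ_∞` for the renormalised self-intersection local time**: if the centred
`T_k - E T_k` converge in `L²(P)` to `γ` (Varadhan), then `E γ² = lim Var(T_k) = ∫ Φ_∞`. This makes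
the target of the second-moment limit (α₁) behind `Stoll1989_invariance_of_secondMomentLimits`
explicit. [cite: LeGall1985, §2] -/
theorem integral_sq_renormalisedSILT_eq {Ω : Type*} [MeasurableSpace Ω] {P : Measure Ω}
    [IsProbabilityMeasure P] {Z : ℝ≥0 → Ω → ℂ} (hZ : IsBrownianComplex Z P)
    (hmeas : ∀ t, Measurable (Z t)) (hcont : ∀ ω, Continuous (Z · ω)) (γ : Ω → ℝ) (hγ : MemLp γ 2 P)
    (hlim : Tendsto (fun k : ℕ => eLpNorm (fun ω =>
      (mollifiedSILT Z k ω - ∫ ω', mollifiedSILT Z k ω' ∂P) - γ ω) 2 P) atTop (𝓝 0)) :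
    ∫ ω, γ ω ^ 2 ∂P = ∫ pq, (1 / (2 * π) ^ 2 *
        (incrCov pq.1.1.toNNReal pq.1.2.toNNReal pq.2.1.toNNReal pq.2.2.toNNReal ^ 2 /
          (|((pq.1.2.toNNReal : ℝ≥0) : ℝ) - pq.1.1.toNNReal| * |((pq.2.2.toNNReal : ℝ≥0) : ℝ) - pq.2.1.toNNReal| *
            (|((pq.1.2.toNNReal : ℝ≥0) : ℝ) - pq.1.1.toNNReal| *
                |((pq.2.2.toNNReal : ℝ≥0) : ℝ) - pq.2.1.toNNReal| -
              incrCov pq.1.1.toNNReal pq.1.2.toNNReal pq.2.1.toNNReal pq.2.2.toNNReal ^ 2)))) ∂(unitSq.prod unitSq) := by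
  -- `∫ T̄_k² = Var(T_k) → ∫ Φ_∞`
  have h1 : Tendsto (fun k : ℕ => ∫ ω, (mollifiedSILT Z k ω - ∫ ω', mollifiedSILT Z k ω' ∂P) ^ 2 ∂P) atTop
      (𝓝 (∫ pq, (1 / (2 * π) ^ 2 *
        (incrCov pq.1.1.toNNReal pq.1.2.toNNReal pq.2.1.toNNReal pq.2.2.toNNReal ^ 2 /
          (|((pq.1.2.toNNReal : ℝ≥0) : ℝ) - pq.1.1.toNNReal| * |((pq.2.2.toNNReal : ℝ≥0) : ℝ) - pq.2.1.toNNReal| *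
            (|((pq.1.2.toNNReal : ℝ≥0) : ℝ) - pq.1.1.toNNReal| *
                |((pq.2.2.toNNReal : ℝ≥0) : ℝ) - pq.2.1.toNNReal| -
              incrCov pq.1.1.toNNReal pq.1.2.toNNReal pq.2.1.toNNReal pq.2.2.toNNReal ^ 2)))) ∂(unitSq.prod unitSq))) := by
    refine (tendsto_variance_mollifiedSILT hZ hmeas hcont).congr fun k => ?_
    have hT := (memLp_mollifiedSILT (P := P) hmeas hcont k 2).aemeasurable
    rw [covariance_self hT, variance_eq_integral hT]
  -- `∫ T̄_k² → ∫ γ²` (convergence of the norms in `L²`)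
  have h2 : Tendsto (fun k : ℕ => ∫ ω, (mollifiedSILT Z k ω - ∫ ω', mollifiedSILT Z k ω' ∂P) ^ 2 ∂P) atTop
      (𝓝 (∫ ω, γ ω ^ 2 ∂P)) := by
    have hTc := fun k => memLp_centred (P := P) hmeas hcont k
    have hLp : Tendsto (fun k : ℕ => (hTc k).toLp _) atTop (𝓝 (hγ.toLp γ)) := by
      rw [Lp.tendsto_Lp_iff_tendsto_eLpNorm']
      refine hlim.congr fun k => ?_
      refine eLpNorm_congr_ae ?_
      filter_upwards [(hTc k).coeFn_toLp, hγ.coeFn_toLp] with ω h1 h2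
      simp only [Pi.sub_apply, h1, h2]
    have hnorm := ((continuous_norm.tendsto _).comp hLp).pow 2
    simp only [Function.comp_def, Lp.norm_toLp] at hnorm
    rw [toReal_eLpNorm_two_sq hγ] at hnorm
    refine hnorm.congr fun k => ?_
    exact toReal_eLpNorm_two_sq (hTc k)
  exact tendsto_nhds_unique h2 h1


end Edwards2D

end Literature.Barriers.CriticalPhenomena

end
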